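import Summits.QuantumFields.YangMills.Theorems.HyperbolicRegulatorHyperbolicToTorusDefs

/-!
# Route `HyperbolicRegulator`, crux `HyperbolicToTorus` (stmt-QuantumFields-15827), line `no_admissible_complex` (v3):
# registered stub `stub_opposite` — opposite-neighbour rigidity of a chart (`IsChart → OppRigid`)

In a chart `ψ` of radius `R` of a graph `Γ` on `ℕ` (`IsChart`: `ψ` injective on the box `|a.1|, |a.2| ≤ R`, lattice
neighbours inside the box adjacent, every interior point certified — its `Γ`-neighbours are images of its lattice
neighbours), the neighbour of `ψ q` OPPOSITE to `ψ (q + e₁)` in the intrinsic sense `IsOpposite` (adjacent to `ψ q`,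
different from `ψ (q + e₁)`, sharing no neighbour with `ψ (q + e₁)` other than `ψ q`) is `ψ (q - e₁)` and no other
vertex, whenever `3 - R ≤ q.1 ≤ R - 1` and `|q.2| ≤ R - 2` (`OppRigid`; the lead's `stub_shellGerm` re-grows shell
vertices from germs at a cone by iterating it via `opp` / `straightIter`).

Proof (elementary lattice bookkeeping, folklore). The neighbours of the interior point `ψ q` are its four chart
neighbours (`StubOpposite.adj_iff`); `ψ (q + e₁)` is excluded by definition, and each perpendicular neighbour
`ψ (q ± e₂)` shares the neighbour `ψ (q + e₁ ± e₂)` with `ψ (q + e₁)`, which is not `ψ q` by injectivity on the box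
(`StubOpposite.psi_ne`). Conversely a common neighbour `z` of `ψ (q - e₁)` and `ψ (q + e₁)` is `ψ p'` for a lattice
neighbour `p'` of the interior point `q - e₁`; if `p' ≠ q` then `p'` is interior as well, so `ψ (q + e₁)` is the
image of a lattice neighbour of `p'`, i.e. `q + e₁` is a lattice neighbour of `p' ∈ {q - 2e₁, q - e₁ ± e₂}` by
injectivity — impossible; hence `z = ψ q`.
-/

set_option autoImplicit false

namespace Summit.QuantumFields.YangMills.Cruxes.HyperbolicToTorus.NoAdmissibleComplex

open Finset

namespace StubOpposite

/-- Box membership of an explicit lattice point from the four linear inequalities (`abs`-free). -/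
theorem inBox_mk {R a b : ℤ} (h : -R ≤ a ∧ a ≤ R ∧ -R ≤ b ∧ b ≤ R) : InBox R (a, b) :=
  ⟨abs_le.2 ⟨h.1, h.2.1⟩, abs_le.2 ⟨h.2.2.1, h.2.2.2⟩⟩

/-- The four linear inequalities satisfied by an explicit box point (`abs`-free). -/
theorem bounds_of_inBox {R a b : ℤ} (h : InBox R (a, b)) : -R ≤ a ∧ a ≤ R ∧ -R ≤ b ∧ b ≤ R :=
  ⟨(abs_le.1 h.1).1, (abs_le.1 h.1).2, (abs_le.1 h.2).1, (abs_le.1 h.2).2⟩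

/-- The unit steps from an explicit lattice point `(x, y)`, with the projections reduced. -/
theorem unitStep_mk_iff {x y : ℤ} {b : ℤ × ℤ} :
    UnitStep (x, y) b ↔ b = (x + 1, y) ∨ b = (x - 1, y) ∨ b = (x, y + 1) ∨ b = (x, y - 1) :=
  Iff.rfl

/-- The adjacency clause of a chart with explicit coordinates: two box points at a unit lattice step (stated as an
`omega`-decidable disjunction of coordinate equations) have adjacent images. -/
theorem adj_of {Γ : SimpleGraph ℕ} {R : ℤ} {ψ : ℤ × ℤ → ℕ} (hC : IsChart Γ R ψ) {a b c d : ℤ}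
    (h1 : InBox R (a, b)) (h2 : InBox R (c, d))
    (hs : (c = a + 1 ∧ d = b) ∨ (c = a - 1 ∧ d = b) ∨ (c = a ∧ d = b + 1) ∨ (c = a ∧ d = b - 1)) :
    Γ.Adj (ψ (a, b)) (ψ (c, d)) := by
  refine hC.2.1 _ _ h1 h2 ?_
  rcases hs with ⟨rfl, rfl⟩ | ⟨rfl, rfl⟩ | ⟨rfl, rfl⟩ | ⟨rfl, rfl⟩
  · exact Or.inl rfl
  · exact Or.inr (Or.inl rfl)
  · exact Or.inr (Or.inr (Or.inl rfl))
  · exact Or.inr (Or.inr (Or.inr rfl))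

/-- **(T1)** In a chart, the neighbours of the image of an INTERIOR point `(x, y)` (`InBox (R - 1)`) are exactly the
images of its four lattice neighbours: the certified clause one way, the adjacency clause the other way (the lattice
neighbours of an interior point lie in the box). -/
theorem adj_iff {Γ : SimpleGraph ℕ} {R : ℤ} {ψ : ℤ × ℤ → ℕ} (hC : IsChart Γ R ψ) {x y : ℤ}
    (hp : InBox (R - 1) (x, y)) {w : ℕ} :
    Γ.Adj (ψ (x, y)) w ↔ w = ψ (x + 1, y) ∨ w = ψ (x - 1, y) ∨ w = ψ (x, y + 1) ∨ w = ψ (x, y - 1) := by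
  have hb := bounds_of_inBox hp
  have hR : InBox R (x, y) := inBox_mk (by omega)
  constructor
  · intro hw
    obtain ⟨b, hs, rfl⟩ := hC.2.2 (x, y) hp w hw
    rcases unitStep_mk_iff.1 hs with rfl | rfl | rfl | rfl
    · exact Or.inl rfl
    · exact Or.inr (Or.inl rfl)
    · exact Or.inr (Or.inr (Or.inl rfl))
    · exact Or.inr (Or.inr (Or.inr rfl))
  · rintro (rfl | rfl | rfl | rfl)
    · exact adj_of hC hR (inBox_mk (by omega)) (by omega)
    · exact adj_of hC hR (inBox_mk (by omega)) (by omega)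
    · exact adj_of hC hR (inBox_mk (by omega)) (by omega)
    · exact adj_of hC hR (inBox_mk (by omega)) (by omega)

/-- **(T2)** Injectivity of a chart on the box, with explicit coordinates and in contrapositive form: box points
differing in some coordinate have different images. -/
theorem psi_ne {Γ : SimpleGraph ℕ} {R : ℤ} {ψ : ℤ × ℤ → ℕ} (hC : IsChart Γ R ψ) {a b c d : ℤ}
    (h1 : InBox R (a, b)) (h2 : InBox R (c, d)) (hne : a ≠ c ∨ b ≠ d) : ψ (a, b) ≠ ψ (c, d) := by
  intro h
  have h' := hC.1 h1 h2 h
  rw [Prod.mk.injEq] at h'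
  omega

end StubOpposite

/-- **Registered stub OPPOSITE** of the skeleton `Lines/no_admissible_complex.lean` (v3): a chart is opposite-rigid,
`IsChart Γ R ψ → OppRigid Γ R ψ`. For `q = (x, y)` with `3 - R ≤ x ≤ R - 1`, `|y| ≤ R - 2`, the points `q`, `q - e₁`,
`q - 2e₁`, `q - e₁ ± e₂` are interior and all their lattice neighbours are in the box. (⇒) an opposite neighbour `u` of
`ψ q` is `ψ p` for a lattice neighbour `p` of `q` (`StubOpposite.adj_iff`); `p = q + e₁` is excluded, and `p = q ± e₂`
would make the common neighbour `ψ (q + e₁ ± e₂)` of `u` and `ψ (q + e₁)` equal to `ψ q`, contradicting injectivity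
(`StubOpposite.psi_ne`); so `u = ψ (q - e₁)`. (⇐) `ψ (q - e₁)` is adjacent to `ψ q`, differs from `ψ (q + e₁)`, and a
common neighbour `z = ψ p'` (`p'` a lattice neighbour of `q - e₁`) of it and `ψ (q + e₁)` has `p' = q`, since otherwise
`q + e₁` would be a lattice neighbour of the interior point `p' ∈ {q - 2e₁, q - e₁ ± e₂}`. -/
theorem stub_opposite :
    ∀ (Γ : SimpleGraph ℕ) (R : ℤ) (ψ : ℤ × ℤ → ℕ), IsChart Γ R ψ → OppRigid Γ R ψ := by
  rintro Γ R ψ hC ⟨x, y⟩ h1 h2 h3 u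
  change 3 - R ≤ x at h1
  change x ≤ R - 1 at h2
  change |y| ≤ R - 2 at h3
  obtain ⟨h3a, h3b⟩ := abs_le.1 h3
  show IsOpposite Γ (ψ (x + 1, y)) (ψ (x, y)) u ↔ u = ψ (x - 1, y)
  -- the interior points used (`InBox (R - 1)`), and the box point `q + e₁`
  have iq : InBox (R - 1) (x, y) := StubOpposite.inBox_mk (by omega)
  have iu : InBox (R - 1) (x - 1, y) := StubOpposite.inBox_mk (by omega)
  have il : InBox (R - 1) (x - 1 - 1, y) := StubOpposite.inBox_mk (by omega)
  have iup : InBox (R - 1) (x - 1, y + 1) := StubOpposite.inBox_mk (by omega)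
  have idn : InBox (R - 1) (x - 1, y - 1) := StubOpposite.inBox_mk (by omega)
  have ba : InBox R (x + 1, y) := StubOpposite.inBox_mk (by omega)
  constructor
  · rintro ⟨hbu, hua, hz⟩
    rcases (StubOpposite.adj_iff hC iq).1 hbu with rfl | rfl | rfl | rfl
    · exact absurd rfl hua
    · rfl
    · -- `u = ψ (q + e₂)` shares the neighbour `ψ (q + e₁ + e₂)` with `ψ (q + e₁)`
      have h := hz (ψ (x + 1, y + 1))
        (StubOpposite.adj_of hC (StubOpposite.inBox_mk (by omega)) (StubOpposite.inBox_mk (by omega)) (by omega))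
        (StubOpposite.adj_of hC (StubOpposite.inBox_mk (by omega)) ba (by omega))
      exact absurd h
        (StubOpposite.psi_ne hC (StubOpposite.inBox_mk (by omega)) (StubOpposite.inBox_mk (by omega)) (by omega))
    · -- `u = ψ (q - e₂)` shares the neighbour `ψ (q + e₁ - e₂)` with `ψ (q + e₁)`
      have h := hz (ψ (x + 1, y - 1))
        (StubOpposite.adj_of hC (StubOpposite.inBox_mk (by omega)) (StubOpposite.inBox_mk (by omega)) (by omega))
        (StubOpposite.adj_of hC (StubOpposite.inBox_mk (by omega)) ba (by omega))
      exact absurd h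
        (StubOpposite.psi_ne hC (StubOpposite.inBox_mk (by omega)) (StubOpposite.inBox_mk (by omega)) (by omega))
  · rintro rfl
    refine ⟨StubOpposite.adj_of hC (StubOpposite.inBox_mk (by omega)) (StubOpposite.inBox_mk (by omega)) (by omega),
      StubOpposite.psi_ne hC (StubOpposite.inBox_mk (by omega)) ba (by omega), ?_⟩
    intro z huz hza
    rcases (StubOpposite.adj_iff hC iu).1 huz with rfl | rfl | rfl | rfl
    · -- `z = ψ (q - e₁ + e₁) = ψ q`
      rw [sub_add_cancel]
    · -- `z = ψ (q - 2e₁)`: then `q + e₁` would be a lattice neighbour of `q - 2e₁`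
      rcases (StubOpposite.adj_iff hC il).1 hza with h | h | h | h <;>
        exact absurd h (StubOpposite.psi_ne hC ba (StubOpposite.inBox_mk (by omega)) (by omega))
    · -- `z = ψ (q - e₁ + e₂)`: then `q + e₁` would be a lattice neighbour of `q - e₁ + e₂`
      rcases (StubOpposite.adj_iff hC iup).1 hza with h | h | h | h <;>
        exact absurd h (StubOpposite.psi_ne hC ba (StubOpposite.inBox_mk (by omega)) (by omega))
    · -- `z = ψ (q - e₁ - e₂)`: then `q + e₁` would be a lattice neighbour of `q - e₁ - e₂`
      rcases (StubOpposite.adj_iff hC idn).1 hza with h | h | h | h <;>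
        exact absurd h (StubOpposite.psi_ne hC ba (StubOpposite.inBox_mk (by omega)) (by omega))

end Summit.QuantumFields.YangMills.Cruxes.HyperbolicToTorus.NoAdmissibleComplex
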